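import Literature.AlgebraicGeometry.Frobenioids.PadicFieldwiseSaturatedTransport
import HarnessLib

/-!
# Frobenioids II, Theorem 2.4 (i), proof p. 20: «`Φ₁` is fieldwise saturated iff `Φ₂` is» from ONE-WAY comparison
# data — the isomorphisms for `Ψ⁻¹` derived from those for `Ψ` (PROOFS)

Mochizuki, *The geometry of Frobenioids II*, Kyushu J. Math. **62** (2008) 401–460, §2, proof of Theorem 2.4 (i),
journal p. 417 ll. 22–28 [cite: MochizukiFrdII2008, Thm 2.4 (i) p.20]: "`Ψ` induces a 1-compatible equivalence of
categories `Ψ^Base : D₁ ⥲ D₂`, as well as compatible isomorphisms of functors `Φ₁ ⥲ Φ₂`, `B₁ ⥲ B₂` … Thus, `Φ₁` is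
fieldwise saturated if and only if `Φ₂` is."

PROOF-ONLY supplement (abc-iut cell, seat abc-iut-w5-d229; SUBDAG-FrdII-Thm24 row L03 `hfs`) to
`PadicFieldwiseSaturatedTransport.lean`, whose `isFieldwiseSaturated_iff_of_equiv` takes the [FrdI] Cor. 4.10 /
4.11 (iii) comparison isomorphisms for `Ψ` AND for `Ψ⁻¹`. Here the data for `Ψ⁻¹` are CONSTRUCTED from those for
`Ψ` and the counit `Ψ^Base (Ψ^Base)⁻¹ X ≅ X` of the equivalence — `Φ₂(X) ≅ Φ₂(Ψ^Base (Ψ^Base)⁻¹ X) ≅ Φ₁((Ψ^Base)⁻¹ X)`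
and likewise for `B`, natural and `Div_B`-compatible — so that the `hfs` input of the typed Theorem 2.4 (i) needs the
Cor. 4.11 (iii) output for `Ψ` only: `isFieldwiseSaturated_iff_of_equiv'`. No definitions; classical; nothing here
bears on [IUTchIII] Cor. 3.12.
-/

noncomputable section

namespace Literature.AlgebraicGeometry.Frobenioids

open CategoryTheory Opposite Function

universe v u

namespace PadicFrd

namespace Datum

variable {D₁ D₂ : Type u} [Category.{v} D₁] [Category.{v} D₂] {p₁ p₂ : ℕ} [Fact p₁.Prime] [Fact p₂.Prime]
  (d₁ : Datum D₁ p₁) (d₂ : Datum D₂ p₂)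

/-- **[FrdII] Thm. 2.4 (i), proof p. 20: «`Φ₁` is fieldwise saturated if and only if `Φ₂` is»**, from an equivalence
`Ψ^Base : D₁ ⥲ D₂` and the compatible isomorphisms `Φ₁ ⥲ Φ₂`, `B₁ ⥲ B₂` for `Ψ` ONLY (the isomorphisms for `Ψ⁻¹`
being obtained by composing with the counit of the equivalence), over two bases with Galois closures, Galois
theory and ramified covers (binders, as in `PadicFieldwiseSaturatedCriterion.lean`).
[cite: MochizukiFrdII2008, Thm 2.4 (i) p.20] -/
theorem isFieldwiseSaturated_iff_of_equiv' (E : D₁ ≌ D₂)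
    (φ : ∀ X : D₁, d₁.Φ.obj (op X) ≃* d₂.Φ.obj (op (E.functor.obj X)))
    (hφ : ∀ ⦃X Y : D₁⦄ (f : Y ⟶ X) (x : d₁.Φ.obj (op X)),
      φ Y ((d₁.Φ.map f.op).hom x) = (d₂.Φ.map (E.functor.map f).op).hom (φ X x))
    (β : ∀ X : D₁, d₁.B.obj (op X) ≃* d₂.B.obj (op (E.functor.obj X)))
    (hβ : ∀ ⦃X Y : D₁⦄ (f : Y ⟶ X) (b : d₁.B.obj (op X)),
      β Y ((d₁.B.map f.op).hom b) = (d₂.B.map (E.functor.map f).op).hom (β X b))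
    (hβdiv : ∀ (X : D₁) (b : d₁.B.obj (op X)),
      Frobenioids.divB d₂.Φ d₂.B d₂.divB (op (E.functor.obj X)) (β X b) =
        MonGp.map (φ X).toMonoidHom (Frobenioids.divB d₁.Φ d₁.B d₁.divB (op X) b))
    (Gal₁ : ∀ ⦃B C : D₁⦄, (B ⟶ C) → Prop) (Gal₂ : ∀ ⦃B C : D₂⦄, (B ⟶ C) → Prop)
    (hdom₁ : ∀ ⦃B₁ C : D₁⦄ (f₁ : B₁ ⟶ C), ∃ (B : D₁) (g : B ⟶ B₁), Gal₁ (g ≫ f₁))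
    (hfix₁ : ∀ ⦃B C : D₁⦄ (f : B ⟶ C), Gal₁ f → ∀ x : d₁.fld B,
      (∀ σ : B ⟶ B, σ ≫ f = f → (d₁.base.map σ).alg x = x) → ∃ x₀ : d₁.fld C, (d₁.base.map f).alg x₀ = x)
    (hram₁ : ∀ (C : D₁) (N : ℕ), 0 < N → ∃ (B : D₁) (f : B ⟶ C), ∀ a : OrdInt (d₁.fld C),
      ∃ b : OrdInt (d₁.fld B), ordIntMapOfHom (d₁.base.map f).alg (d₁.base.map f).isValHom a = b ^ N)
    (hdom₂ : ∀ ⦃B₁ C : D₂⦄ (f₁ : B₁ ⟶ C), ∃ (B : D₂) (g : B ⟶ B₁), Gal₂ (g ≫ f₁))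
    (hfix₂ : ∀ ⦃B C : D₂⦄ (f : B ⟶ C), Gal₂ f → ∀ x : d₂.fld B,
      (∀ σ : B ⟶ B, σ ≫ f = f → (d₂.base.map σ).alg x = x) → ∃ x₀ : d₂.fld C, (d₂.base.map f).alg x₀ = x)
    (hram₂ : ∀ (C : D₂) (N : ℕ), 0 < N → ∃ (B : D₂) (f : B ⟶ C), ∀ a : OrdInt (d₂.fld C),
      ∃ b : OrdInt (d₂.fld B), ordIntMapOfHom (d₂.base.map f).alg (d₂.base.map f).isValHom a = b ^ N) :
    d₁.IsFieldwiseSaturated ↔ d₂.IsFieldwiseSaturated := by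
  -- the counit `c_X : Ψ^Base (Ψ^Base)⁻¹ X ≅ X` and the induced isomorphisms of `Φ₂`, `B₂`
  let c : ∀ X₂ : D₂, E.functor.obj (E.inverse.obj X₂) ≅ X₂ := fun X₂ => E.counitIso.app X₂
  have hc : ∀ ⦃X Y : D₂⦄ (f : Y ⟶ X), E.functor.map (E.inverse.map f) ≫ (c X).hom = (c Y).hom ≫ f :=
    fun X Y f => E.counit.naturality f
  let tΦ : ∀ X₂ : D₂, d₂.Φ.obj (op X₂) ≃* d₂.Φ.obj (op (E.functor.obj (E.inverse.obj X₂))) :=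
    fun X₂ => (d₂.Φ.mapIso (c X₂).op).commMonCatIsoToMulEquiv
  have htΦ : ∀ (X₂ : D₂) (x : d₂.Φ.obj (op X₂)), tΦ X₂ x = (d₂.Φ.map (c X₂).hom.op).hom x := fun _ _ => rfl
  let tB : ∀ X₂ : D₂, d₂.B.obj (op X₂) ≃* d₂.B.obj (op (E.functor.obj (E.inverse.obj X₂))) :=
    fun X₂ => (d₂.B.mapIso (c X₂).op).commMonCatIsoToMulEquiv
  have htB : ∀ (X₂ : D₂) (b : d₂.B.obj (op X₂)), tB X₂ b = (d₂.B.map (c X₂).hom.op).hom b := fun _ _ => rfl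
  -- the comparison isomorphisms for `Ψ⁻¹`
  let φ' : ∀ X₂ : D₂, d₂.Φ.obj (op X₂) ≃* d₁.Φ.obj (op (E.inverse.obj X₂)) :=
    fun X₂ => (tΦ X₂).trans (φ (E.inverse.obj X₂)).symm
  let β' : ∀ X₂ : D₂, d₂.B.obj (op X₂) ≃* d₁.B.obj (op (E.inverse.obj X₂)) :=
    fun X₂ => (tB X₂).trans (β (E.inverse.obj X₂)).symm
  have hφ'apply : ∀ (X₂ : D₂) (x : d₂.Φ.obj (op X₂)),
      φ (E.inverse.obj X₂) (φ' X₂ x) = (d₂.Φ.map (c X₂).hom.op).hom x := fun X₂ x => by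
    change φ _ ((φ _).symm (tΦ X₂ x)) = _
    rw [MulEquiv.apply_symm_apply, htΦ]
  have hβ'apply : ∀ (X₂ : D₂) (b : d₂.B.obj (op X₂)),
      β (E.inverse.obj X₂) (β' X₂ b) = (d₂.B.map (c X₂).hom.op).hom b := fun X₂ b => by
    change β _ ((β _).symm (tB X₂ b)) = _
    rw [MulEquiv.apply_symm_apply, htB]
  refine isFieldwiseSaturated_iff_of_equiv d₁ d₂ E φ hφ β hβ hβdiv φ' ?_ β' ?_ ?_ Gal₁ Gal₂ hdom₁ hfix₁ hram₁
    hdom₂ hfix₂ hram₂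
  · -- naturality of `φ'`
    intro X Y f x
    apply (φ (E.inverse.obj Y)).injective
    rw [hφ'apply, hφ, hφ'apply, ← CommMonCat.comp_apply, ← CommMonCat.comp_apply, ← d₂.Φ.map_comp,
      ← d₂.Φ.map_comp, ← op_comp, ← op_comp, hc]
  · -- naturality of `β'`
    intro X Y f b
    apply (β (E.inverse.obj Y)).injective
    rw [hβ'apply, hβ, hβ'apply, ← CommMonCat.comp_apply, ← CommMonCat.comp_apply, ← d₂.B.map_comp,
      ← d₂.B.map_comp, ← op_comp, ← op_comp, hc]
  · -- `Div_B`-compatibility of `(φ', β')`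
    intro X b
    haveI : IsCancelMul (d₂.Φ.obj (op (E.functor.obj (E.inverse.obj X)))) :=
      (d₂.isMonoprime (op (E.functor.obj (E.inverse.obj X)))).isCancelMul
    apply MonGp.map_injective (φ (E.inverse.obj X)).toMonoidHom (φ (E.inverse.obj X)).injective
    have hcomp : (φ (E.inverse.obj X)).toMonoidHom.comp (φ' X).toMonoidHom = (d₂.Φ.map (c X).hom.op).hom := by
      ext x
      exact hφ'apply X x
    rw [← hβdiv, ← MonoidHom.comp_apply, ← MonGp.map_comp, hcomp, hβ'apply, d₂.divB_mapB (c X).hom b]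
    rfl

end Datum

end PadicFrd

end Literature.AlgebraicGeometry.Frobenioids

end
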